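import Summits.BirchSwinnertonDyer.BirchSwinnertonDyer.Theorems.SylvesterTwoHeegnerIndexCMDataDerivative
import Summits.BirchSwinnertonDyer.Rank1Residual.X11b.RingClassGalArtin
import Summits.BirchSwinnertonDyer.Rank1Residual.X11b.KolyvaginH44ConcreteData
import Literature.NumberTheory.QuadraticFields.RingClassGroupTower
import HarnessLib

/-!
# DATA LAYER (R-e1) of leaf (L1), crux `UpperOffV0HSYPlus` (stmt-BirchSwinnertonDyer-19804): the
# two-prime level `9p(ℓℓ')` of Hu–Shu–Yin's CM tower — `Gal(K[9pℓℓ']/K[9p]) = G_ℓ · G_ℓ'` and (ES1)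
# at each prime of the pair inside `E(K[9p(ℓℓ')])` (the level of the classes `c_B(ℓℓ')` of (L1))

Skeleton of record VARIANT M (`Cruxes/UpperOffV0HSYPlus/Lines/coupled_variantM.lean` 406ca288e244d392);
line card v24, residual (R).  The classes `c_B(ℓℓ')` of leaf (L1) (#24 p654717, second ∃-block, level
`ringClassField K ιK (9 * p * (ℓ * ℓ'))`) need the derived CM point `D_ℓ D_ℓ' y_{ℓℓ'}` and its invariance
modulo `2^M` under `Gal(K[9pℓℓ']/K[9p])` (sibling file `…CMDataPairDerivative`).  Inputs proved here:

* `ringClassGalOver_nine_mul_le_sup` — **`Gal(K[n]/K[9p]) ≤ G_ℓ ⊔ G_ℓ'`**, `n = 9p(ℓℓ')`,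
  `G_ℓ = Gal(K[n]/K[9pℓ'])`, `G_ℓ' = Gal(K[n]/K[9pℓ])` (Gross 1991 §3 "`G_n ≃ ∏ G_ℓ`" at HSY's base
  conductor `9p`): the ring-class-group identity `ker(→ 9p) ≤ ker(→ 9pℓ') ⊔ ker(→ 9pℓ)` (Cox (7.27); the
  tree's `RingClass.ker_restrict_le_ker_sup_ker` at `(ℓ, c, d) = (ℓ, ℓ', 9p)`) through x11b3's Artin
  transport `RingClassTower.ringClassGalOver_le_sup`;
* `sum_pointGalHom_eq_lFunction_smul_sylvester_pair_left` / `_right` — **(ES1) at `ℓ` and at `ℓ'`**: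
  `Σ_{g ∈ G_ℓ} g • y_{ℓℓ'} = a_ℓ • y_{ℓ'}`, `Σ_{g ∈ G_ℓ'} g • y_{ℓℓ'} = a_ℓ' • y_ℓ` in `E(K[9p(ℓℓ')])`
  (`HeegnerTraceOrders.sum_pointGalHom_eq_lFunction_smul_of_fix`, resp. p627619 at `(n, ℓ) := (ℓ, ℓ')`).

HONEST FRAMING: theorems only (no definition, no named fact, no instance, no notation); assembly of PROVED
tree theorems; nothing about Sel/Ш/FLIP/display/BSD; no stub closed; `--supports stmt-BirchSwinnertonDyer-19804 --as helper`.

## References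
* B. H. Gross, LMS LNS 153 (1991), §3 Prop. 3.7 (1), "G_n ≃ ∏ G_ℓ" (PDF p. 217). [GrossLMS1991]
* D. A. Cox, *Primes of the form x² + ny²*, 2nd ed., §7.D (7.27), §9.A. [Cox2013]
* J. Nekovář, LMS LNS 320 (2007), Prop. (4.13) (i). [Nekovar2007]
* Y. Hu, J. Shu, H. Yin, Trans. AMS 372 (2019), arXiv 1708.05266 §4.1. [HuShuYin2019]

## Mathlib / tree search
Tree: `RingClass.ker_restrict_le_ker_sup_ker`, `span_natCast_ne_top_of_ne_one` (`QuadraticFields/RingClassGroupTower`);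
x11b3 `RingClassTower.ringClassGalOver_le_sup` (`X11b/RingClassGalArtin`); `sylvesterForm_mem_heegnerForms`,
`levelTransport_self_sylvesterPoint_of_fix`, `isCoprime_C_of_forall_prime_mod_three_eq_two`,
`sum_pointGalHom_eq_lFunction_smul_sylvesterTower`; `isHeckeNeighbour_heegnerTau_conductorMul`.
`lean search 'ringClassGalOver_nine_mul_le_sup|sylvester_pair'` → nothing before this file. presearch: n/a (assembly).
-/

set_option linter.dupNamespace false -- Summits modules are `Summit.<Summit>.<Problem>…` by design

noncomputable section

open scoped Classical

namespace Summit.BirchSwinnertonDyer.BirchSwinnertonDyer.Theorems.SylvesterTwoCMData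

open Complex UpperHalfPlane NumberField WeierstrassCurve Finset
open Literature.NumberTheory.EllipticCurves Literature.NumberTheory.EllipticCurves.ModularForms
  Literature.NumberTheory.EllipticCurves.HuShuYin2019
  Literature.NumberTheory.QuadraticFields.BinaryQuadraticForm
  Literature.NumberTheory.QuadraticFields.Quadratic
  Literature.NumberTheory.QuadraticFields Literature.NumberTheory.QuadraticFields.RingClass
  Literature.NumberTheory.EllipticCurves.KolyvaginEuler
  Summit.BirchSwinnertonDyer.Rank1Residual.X11b.RingClassTower
  Summit.BirchSwinnertonDyer.Rank1Residual.X11b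

variable {K : Type} [Field K] [NumberField K]

/-! ### `Gal(K[9pℓℓ']/K[9p]) = G_ℓ · G_ℓ'` -/

/-- **`Gal(K[n]/K[9p]) ≤ Gal(K[n]/K[9pℓ']) ⊔ Gal(K[n]/K[9pℓ])`, `n = 9p·ℓℓ'`** (`K[9pℓ] ∩ K[9pℓ'] = K[9p]`
inside `K[n]`; Gross's "`G_n ≃ ∏ G_ℓ`" at HSY's base conductor `9p`): the ring-class-group identity
`ker_restrict_le_ker_sup_ker` at `(ℓ, c, d) = (ℓ, ℓ', 9p)` through the Artin transport
`ringClassGalOver_le_sup`. [cite: GrossLMS1991, §3 (PDF p. 217 l. 1–3)] [cite: Cox2013, §7.D (7.27), §9.A] -/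
theorem ringClassGalOver_nine_mul_le_sup (hK : IsImaginaryQuadratic K) (ι : K →+* ℂ) {p ℓ ℓ' : ℕ}
    (hp0 : p ≠ 0) (hℓ : ℓ.Prime) (hℓ' : ℓ'.Prime) (hne : ℓ ≠ ℓ') (hℓp : ¬ ℓ ∣ 9 * p)
    (hℓ'p : ¬ ℓ' ∣ 9 * p) :
    ringClassGalOver ι (9 * p * (ℓ * ℓ')) (9 * p) ≤
      ringClassGalOver ι (9 * p * (ℓ * ℓ')) (9 * p * ℓ') ⊔ ringClassGalOver ι (9 * p * (ℓ * ℓ')) (9 * p * ℓ) := by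
  have hn0 : 9 * p * (ℓ * ℓ') ≠ 0 := mul_ne_zero (mul_ne_zero (by norm_num) hp0) (mul_ne_zero hℓ.ne_zero hℓ'.ne_zero)
  have hd : 9 * p ∣ 9 * p * (ℓ * ℓ') := dvd_mul_right _ _
  have ha : 9 * p * ℓ' ∣ 9 * p * (ℓ * ℓ') := ⟨ℓ, by ring⟩
  have hb : 9 * p * ℓ ∣ 9 * p * (ℓ * ℓ') := ⟨ℓ', by ring⟩
  obtain ⟨bs, hbs⟩ := exists_basis_zero_eq_one hK.1
  have hω := basis_one_mul_self_eq bs hbs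
  have hℓℓ' : Nat.Coprime ℓ ℓ' := (Nat.coprime_primes hℓ hℓ').mpr hne
  have hℓd : Nat.Coprime ℓ (9 * p) := (Nat.Prime.coprime_iff_not_dvd hℓ).mpr hℓp
  have hℓ'd : Nat.Coprime ℓ' (9 * p) := (Nat.Prime.coprime_iff_not_dvd hℓ').mpr hℓ'p
  have hfn : Ideal.span {((9 * p * (ℓ * ℓ') : ℕ) : 𝓞 K)} ≠ ⊤ :=
    span_natCast_ne_top_of_ne_one bs hbs (by
      intro h
      have h1 : 1 ≤ p * (ℓ * ℓ') :=
        Nat.one_le_iff_ne_zero.mpr (mul_ne_zero hp0 (mul_ne_zero hℓ.ne_zero hℓ'.ne_zero))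
      have h2 : 9 * p * (ℓ * ℓ') = 9 * (p * (ℓ * ℓ')) := by ring
      omega)
  have hker := ker_restrict_le_ker_sup_ker (K := K) bs hbs hω (ℓ := ℓ) (c := ℓ') (d := 9 * p)
    (m₁ := 9 * p * ℓ') (m₂ := 9 * p * ℓ) (n := 9 * p * (ℓ * ℓ')) (by ring) (by ring) (by ring)
    hℓℓ' hℓd hℓ'd hfn hd ha hb
  refine ringClassGalOver_le_sup hK ι hn0 ha hb hd fun x hx ↦ ?_
  -- element form (as x11b3's `exists_mul_eq_of_restrict_div_eq_one`: `A ⊔ B = A · B` for normal subgroups)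
  set A : Subgroup (RingClassGroup K (9 * p * (ℓ * ℓ'))) := (restrict (K := K) ha).ker with hA
  set B : Subgroup (RingClassGroup K (9 * p * (ℓ * ℓ'))) := (restrict (K := K) hb).ker with hB
  have hx' : x ∈ (restrict (K := K) hd).ker := (MonoidHom.mem_ker).mpr hx
  have h : x ∈ A ⊔ B := hker hx'
  have hset : x ∈ ((A ⊔ B : Subgroup (RingClassGroup K (9 * p * (ℓ * ℓ')))) :
      Set (RingClassGroup K (9 * p * (ℓ * ℓ')))) := h
  rw [Subgroup.mul_normal A B] at hset
  obtain ⟨y, hy, z, hz, hyz⟩ := Set.mem_mul.mp hset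
  refine ⟨y, z, ?_, ?_, hyz.symm⟩
  · have hy' : y ∈ A := hy
    rw [hA] at hy'
    exact (MonoidHom.mem_ker).mp hy'
  · have hz' : z ∈ B := hz
    rw [hB] at hz'
    exact (MonoidHom.mem_ker).mp hz'


/-! ### (ES1) at each prime of the pair, inside `E(K[9p(ℓℓ')])` -/

/-- **(ES1) at `ℓ` over `K[9pℓ']`: `Σ_{g ∈ G_ℓ} g • y_{ℓℓ'} = a_ℓ • y_{ℓ'}` in `E(K[9p(ℓℓ')])`**
(`G_ℓ = Gal(K[9pℓℓ']/K[9pℓ'])`; `y_{ℓℓ'}` over `φ(τ_{Q^{(ℓℓ')}})`, `y_{ℓ'}` over `φ(τ_{Q^{(ℓ')}})`; the level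
written `9·p·(ℓ·ℓ')` as in #24). [cite: GrossLMS1991, Prop. 3.7 (1) (p. 240)] [cite: Nekovar2007, Prop. (4.13) (i)] -/
theorem sum_pointGalHom_eq_lFunction_smul_sylvester_pair_left (hK : IsImaginaryQuadratic K)
    (hdK : NumberField.discr K = -3) (ι : K →+* ℂ) {W : WeierstrassCurve ℚ}
    (Dt : ModularParametrizationData W 243) {p ℓ ℓ' : ℕ} (hp : p % 3 = 1) (hℓ : ℓ.Prime)
    (hℓ3 : ℓ % 3 = 2) (hℓ' : ℓ'.Prime) (hℓ'3 : ℓ' % 3 = 2) (hne : ℓ ≠ ℓ') (hℓp : ¬ ℓ ∣ p)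
    (hinert : (Ideal.span {(ℓ : 𝓞 K)}).IsPrime)
    {G : Finset (ringClassField K ι (9 * p * (ℓ * ℓ')) ≃ₐ[ℚ] ringClassField K ι (9 * p * (ℓ * ℓ')))}
    (hG : ∀ g, g ∈ G ↔ g ∈ ringClassGalOver ι (9 * p * (ℓ * ℓ')) (9 * p * ℓ'))
    {y yℓ' : (W.baseChange (ringClassField K ι (9 * p * (ℓ * ℓ')))).toAffine.Point}
    (hy : Affine.Point.map (W' := W) (ringClassField K ι (9 * p * (ℓ * ℓ'))).subtype.toRatAlgHom y =
      Dt.φ (heegnerTau (((ℓ * ℓ' : ℕ) : ℤ) ^ 2 * (81 * ((p : ℤ) ^ 2 + 4 * p + 16)),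
        ((ℓ * ℓ' : ℕ) : ℤ) * (-(9 * (4 * (p : ℤ) ^ 2 + 17 * p + 72))), 4 * (p : ℤ) ^ 2 + 18 * p + 81)))
    (hyℓ' : Affine.Point.map (W' := W) (ringClassField K ι (9 * p * (ℓ * ℓ'))).subtype.toRatAlgHom yℓ' =
      Dt.φ (heegnerTau ((ℓ' : ℤ) ^ 2 * (81 * ((p : ℤ) ^ 2 + 4 * p + 16)),
        (ℓ' : ℤ) * (-(9 * (4 * (p : ℤ) ^ 2 + 17 * p + 72))), 4 * (p : ℤ) ^ 2 + 18 * p + 81))) :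
    ∑ g ∈ G, pointGalHom W (ringClassField K ι (9 * p * (ℓ * ℓ'))) g y = W.LFunction ℓ • yℓ' := by
  haveI : NeZero (243 : ℕ) := ⟨by norm_num⟩
  have hp0 : p ≠ 0 := by rintro rfl; simp at hp
  have hℓ3' : ℓ ≠ 3 := by rintro rfl; simp at hℓ3
  have hℓN : ¬ ℓ ∣ 243 := by
    intro h
    have h' : ℓ ∣ 3 ^ 5 := by norm_num; exact h
    exact hℓ3' ((Nat.prime_dvd_prime_iff_eq hℓ Nat.prime_three).mp (hℓ.dvd_of_dvd_pow h'))
  have hℓ9 : ¬ ℓ ∣ 9 := by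
    intro h
    have h' : ℓ ∣ 3 ^ 2 := by norm_num; exact h
    exact hℓ3' ((Nat.prime_dvd_prime_iff_eq hℓ Nat.prime_three).mp (hℓ.dvd_of_dvd_pow h'))
  have hℓℓ' : ¬ ℓ ∣ ℓ' := fun h ↦ hne ((Nat.prime_dvd_prime_iff_eq hℓ hℓ').mp h)
  have hℓf : ¬ ℓ ∣ 9 * p * ℓ' := by
    intro h
    rcases (Nat.Prime.dvd_mul hℓ).mp h with h9p | h'
    · rcases (Nat.Prime.dvd_mul hℓ).mp h9p with h9 | hp'
      · exact hℓ9 h9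
      · exact hℓp hp'
    · exact hℓℓ' h'
  have hf : 9 * p * ℓ' ≠ 0 := mul_ne_zero (mul_ne_zero (by norm_num) hp0) hℓ'.ne_zero
  have hunits : 2 ≤ 9 * p * ℓ' ∨ NumberField.discr K < -4 := by
    left
    have h1 : 1 ≤ p * ℓ' := Nat.one_le_iff_ne_zero.mpr (mul_ne_zero hp0 hℓ'.ne_zero)
    have h2 : 9 * p * ℓ' = 9 * (p * ℓ') := by ring
    omega
  have hlev : ℓ * (9 * p * ℓ') = 9 * p * (ℓ * ℓ') := by ring
  have h3ℓ' : ¬ 3 ∣ ℓ' := fun h ↦ by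
    have := (Nat.prime_dvd_prime_iff_eq Nat.prime_three hℓ').mp h
    omega
  have hℓ'C : IsCoprime (ℓ' : ℤ) (4 * (p : ℤ) ^ 2 + 18 * p + 81) :=
    isCoprime_C_of_forall_prime_mod_three_eq_two (p := p) (n := ℓ') hℓ'.ne_zero fun q hq ↦ by
      rw [hℓ'.primeFactors, Finset.mem_singleton] at hq
      rw [hq]; exact hℓ'3
  have hℓℓ'C : IsCoprime ((ℓ * ℓ' : ℕ) : ℤ) (4 * (p : ℤ) ^ 2 + 18 * p + 81) :=
    isCoprime_C_of_forall_prime_mod_three_eq_two (p := p) (n := ℓ * ℓ') (mul_ne_zero hℓ.ne_zero hℓ'.ne_zero)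
      fun q hq ↦ by
      rw [Nat.primeFactors_mul hℓ.ne_zero hℓ'.ne_zero, Finset.mem_union, hℓ.primeFactors, hℓ'.primeFactors,
        Finset.mem_singleton, Finset.mem_singleton] at hq
      rcases hq with rfl | rfl
      · exact hℓ3
      · exact hℓ'3
  -- base form `Q^{(ℓ')}` and top form `Q^{(ℓℓ')} = conductorMul ℓ Q^{(ℓ')}`
  have hQ := sylvesterForm_mem_heegnerForms (n := ℓ') hp hℓ'.ne_zero hℓ'C
  have hQ' := sylvesterForm_mem_heegnerForms (n := ℓ * ℓ') hp (mul_ne_zero hℓ.ne_zero hℓ'.ne_zero) hℓℓ'C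
  have hQeq : ((((ℓ * ℓ' : ℕ) : ℤ)) ^ 2 * (81 * ((p : ℤ) ^ 2 + 4 * p + 16)),
      ((ℓ * ℓ' : ℕ) : ℤ) * (-(9 * (4 * (p : ℤ) ^ 2 + 17 * p + 72))), 4 * (p : ℤ) ^ 2 + 18 * p + 81) =
      ((ℓ : ℤ) ^ 2 * ((ℓ' : ℤ) ^ 2 * (81 * ((p : ℤ) ^ 2 + 4 * p + 16))),
        (ℓ : ℤ) * ((ℓ' : ℤ) * (-(9 * (4 * (p : ℤ) ^ 2 + 17 * p + 72)))), 4 * (p : ℤ) ^ 2 + 18 * p + 81) := by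
    ext <;> push_cast <;> ring
  have hD : ((ℓ' : ℤ) ^ 2 * (81 * ((p : ℤ) ^ 2 + 4 * p + 16)), (ℓ' : ℤ) * (-(9 * (4 * (p : ℤ) ^ 2 + 17 * p + 72))),
      4 * (p : ℤ) ^ 2 + 18 * p + 81).2.1 ^ 2 -
      4 * ((ℓ' : ℤ) ^ 2 * (81 * ((p : ℤ) ^ 2 + 4 * p + 16)), (ℓ' : ℤ) * (-(9 * (4 * (p : ℤ) ^ 2 + 17 * p + 72))),
        4 * (p : ℤ) ^ 2 + 18 * p + 81).1 * ((ℓ' : ℤ) ^ 2 * (81 * ((p : ℤ) ^ 2 + 4 * p + 16)),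
          (ℓ' : ℤ) * (-(9 * (4 * (p : ℤ) ^ 2 + 17 * p + 72))), 4 * (p : ℤ) ^ 2 + 18 * p + 81).2.2 < 0 := by
    rw [hQ.1]
    have : (0 : ℤ) < ((9 * p * ℓ' : ℕ) : ℤ) ^ 2 := by positivity
    linarith
  have hx' : IsHeckeNeighbour 243 ℓ
      (heegnerTau ((ℓ' : ℤ) ^ 2 * (81 * ((p : ℤ) ^ 2 + 4 * p + 16)),
        (ℓ' : ℤ) * (-(9 * (4 * (p : ℤ) ^ 2 + 17 * p + 72))), 4 * (p : ℤ) ^ 2 + 18 * p + 81))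
      (heegnerTau ((((ℓ * ℓ' : ℕ) : ℤ)) ^ 2 * (81 * ((p : ℤ) ^ 2 + 4 * p + 16)),
        ((ℓ * ℓ' : ℕ) : ℤ) * (-(9 * (4 * (p : ℤ) ^ 2 + 17 * p + 72))), 4 * (p : ℤ) ^ 2 + 18 * p + 81)) := by
    rw [hQeq]
    exact isHeckeNeighbour_heegnerTau_conductorMul hQ.2.1 hD hℓ
  have hQ'disc : discr ((((ℓ * ℓ' : ℕ) : ℤ)) ^ 2 * (81 * ((p : ℤ) ^ 2 + 4 * p + 16)),
      ((ℓ * ℓ' : ℕ) : ℤ) * (-(9 * (4 * (p : ℤ) ^ 2 + 17 * p + 72))), 4 * (p : ℤ) ^ 2 + 18 * p + 81) =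
      ((9 * p * (ℓ * ℓ') : ℕ) : ℤ) ^ 2 * NumberField.discr K := by
    rw [hdK]; exact hQ'.1
  exact HeegnerTraceOrders.sum_pointGalHom_eq_lFunction_smul_of_fix hK ι Dt hℓ hinert hℓN hℓf hf hunits
    hlev (fun σ hσ ↦ levelTransport_self_sylvesterPoint_of_fix hK hdK ι hp hℓ'.ne_zero h3ℓ' hℓ'C hσ) hQ'.2.1
    ((isPrimitive_iff_binQF _).mpr ((BinQF.isPrimitive_iff _).mpr hQ'.2.2.2)) hQ'disc hx' hG hy hyℓ'

/-- **(ES1) at `ℓ'` over `K[9pℓ]`: `Σ_{g ∈ G_ℓ'} g • y_{ℓℓ'} = a_ℓ' • y_ℓ` in `E(K[9p(ℓℓ')])`** — p627619's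
`sum_pointGalHom_eq_lFunction_smul_sylvesterTower` at `(n, ℓ) := (ℓ, ℓ')`.
[cite: GrossLMS1991, Prop. 3.7 (1) (p. 240)] [cite: Nekovar2007, Prop. (4.13) (i)] -/
theorem sum_pointGalHom_eq_lFunction_smul_sylvester_pair_right (hK : IsImaginaryQuadratic K)
    (hdK : NumberField.discr K = -3) (ι : K →+* ℂ) {W : WeierstrassCurve ℚ}
    (Dt : ModularParametrizationData W 243) {p ℓ ℓ' : ℕ} (hp : p % 3 = 1) (hℓ : ℓ.Prime)
    (hℓ3 : ℓ % 3 = 2) (hℓ' : ℓ'.Prime) (hℓ'3 : ℓ' % 3 = 2) (hne : ℓ ≠ ℓ') (hℓ'p : ¬ ℓ' ∣ p)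
    (hinert' : (Ideal.span {(ℓ' : 𝓞 K)}).IsPrime)
    {G : Finset (ringClassField K ι (9 * p * (ℓ * ℓ')) ≃ₐ[ℚ] ringClassField K ι (9 * p * (ℓ * ℓ')))}
    (hG : ∀ g, g ∈ G ↔ g ∈ ringClassGalOver ι (9 * p * (ℓ * ℓ')) (9 * p * ℓ))
    {y yℓ : (W.baseChange (ringClassField K ι (9 * p * (ℓ * ℓ')))).toAffine.Point}
    (hy : Affine.Point.map (W' := W) (ringClassField K ι (9 * p * (ℓ * ℓ'))).subtype.toRatAlgHom y =
      Dt.φ (heegnerTau (((ℓ * ℓ' : ℕ) : ℤ) ^ 2 * (81 * ((p : ℤ) ^ 2 + 4 * p + 16)),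
        ((ℓ * ℓ' : ℕ) : ℤ) * (-(9 * (4 * (p : ℤ) ^ 2 + 17 * p + 72))), 4 * (p : ℤ) ^ 2 + 18 * p + 81)))
    (hyℓ : Affine.Point.map (W' := W) (ringClassField K ι (9 * p * (ℓ * ℓ'))).subtype.toRatAlgHom yℓ =
      Dt.φ (heegnerTau ((ℓ : ℤ) ^ 2 * (81 * ((p : ℤ) ^ 2 + 4 * p + 16)),
        (ℓ : ℤ) * (-(9 * (4 * (p : ℤ) ^ 2 + 17 * p + 72))), 4 * (p : ℤ) ^ 2 + 18 * p + 81))) :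
    ∑ g ∈ G, pointGalHom W (ringClassField K ι (9 * p * (ℓ * ℓ'))) g y = W.LFunction ℓ' • yℓ := by
  have hℓ'ℓ : ¬ ℓ' ∣ ℓ := fun h ↦ hne ((Nat.prime_dvd_prime_iff_eq hℓ' hℓ).mp h).symm
  have hℓ'pℓ : ¬ ℓ' ∣ p * ℓ := by
    intro h
    rcases (Nat.Prime.dvd_mul hℓ').mp h with h1 | h2
    · exact hℓ'p h1
    · exact hℓ'ℓ h2
  exact sum_pointGalHom_eq_lFunction_smul_sylvesterTower hK hdK ι Dt hp hℓ.ne_zero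
    (fun q hq ↦ by rw [hℓ.primeFactors, Finset.mem_singleton] at hq; rw [hq]; exact hℓ3)
    hℓ' hℓ'3 hℓ'pℓ hinert' hG hy hyℓ

end Summit.BirchSwinnertonDyer.BirchSwinnertonDyer.Theorems.SylvesterTwoCMData

end
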